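import Summits.BirchSwinnertonDyer.BirchSwinnertonDyer.Theorems.SignedLowerHalvesSmallImageLowerHalfBothSignsRttCharRoadE1LocalSatTransport
import Summits.BirchSwinnertonDyer.BirchSwinnertonDyer.Theorems.SignedLowerHalvesSmallImageLowerHalfBothSignsRttCharRoadE1SatIntKobayashi
import Literature.NumberTheory.EllipticCurves.H1CorestrictionIndexTwo
import HarnessLib

/-!
# Route `SignedLowerHalves`, crux L `SmallImageLowerHalfBothSigns` (stmt-BirchSwinnertonDyer-23599), line `rtt_w3` v12 — glue `charRoad_injTop`,
# LEAD: block T, PER COORDINATE (K-side, generic) — from a layer representative of `s ∈ Sel^{sat}(θ)[π]` to the three descent inputs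

WHY: in `injTop_of_inputs` (INPUT SPEC, bus 2026-08-30) a class of `Sel^{ε,S₀K}_R(K_n, M)` represented by an `M[π]`-valued cocycle `φ` is pushed along a
COORDINATE `t : M →+ W_K[p^∞]` (honda's `s_l`, or its twist `û ∘ s_l`) to the cocycle `ψ = t ∘ φ`; the descent bricks (p767713/p768350/p768739, level `∞`:
p769542) then need exactly: `p • [ψ] = 0`, `[ψ] ∈` Kobayashi's condition `E^ε(K_n·K_v)` at every `v ∣ p`, and `[ψ]` unramified outside `S₀K ∪ {p}`.
This file derives the three from the coordinate's published hypotheses (local equivariance at `v ∣ p`, the closure condition `hgen`, equivariance on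
`M[π]`) via -w3 g17's ★ `mem_signedTransportSelmerLayerSat_of_comp` (p764811) and the LEAD's p767729; and shows that the TWISTED coordinate `û ∘ t`
inherits the hypotheses from `t` when `û` is locally equivariant, Kummer-stable (honda p768703 shape) and `Γ_K`-equivariant on `W_K[p]`.

WHAT: `descInputs_of_coordinate` ★, `coordinate_hyps_comp` ★ (twist inheritance), `nsmul_oneCocycleClass_eq_zero_of_forall`. THEOREMS ONLY, generic
(any number field `K`, curve `V/K`, discrete `Γ_K`-module `M` with commuting `R`-scalars). [cite: Kobayashi2003, Def. 1.1] [cite: SerreGaloisCohomology1997, I §2.2, I §5.1]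
-/

set_option linter.dupNamespace false -- D-0017: single-problem summit, the namespace repeats the problem name by design

noncomputable section

open scoped Classical

universe u

namespace Summit.BirchSwinnertonDyer.BirchSwinnertonDyer.Theorems.SmallImageCharSignedSelmer

open NumberField IsDedekindDomain Field Literature.NumberTheory.EllipticCurves Literature.NumberTheory.GaloisRepresentations
  Literature.NumberTheory.EllipticCurves.GreenbergSelmer Literature.NumberTheory.EllipticCurves.GreenbergVatsal2000 Kobayashi2003
  WeierstrassCurve

section Generic

variable {G : Type u} [Group G] [TopologicalSpace G] [IsTopologicalGroup G] {M : Type u} [AddCommGroup M] [DistribMulAction G M] [TopologicalSpace M]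
  [DiscreteTopology M]

/-- A cocycle killed pointwise by `k` has class killed by `k`. [folklore] -/
theorem nsmul_oneCocycleClass_eq_zero_of_forall (k : ℕ) (f : contOneCocycles (discreteTopRep G M)) (hf : ∀ x, k • f.1 x = 0) :
    k • oneCocycleClass (discreteTopRep G M) f = 0 := by
  have hkf : k • f = 0 := Subtype.ext (ContinuousMap.ext fun x ↦ by rw [nsmul_apply_val]; exact hf x)
  rw [← classHom_apply, ← map_nsmul, hkf, map_zero]

end Generic

section Coordinate

variable {K : Type u} [Field K] [NumberField K] {p : ℕ} [hp : Fact p.Prime] (κ : ZpExtension K p) (V : WeierstrassCurve K)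
  (S₀ : Set (HeightOneSpectrum (𝓞 K))) (ε : ℤˣ)
  {M : Type u} [AddCommGroup M] [DistribMulAction (absoluteGaloisGroup K) M] [TopologicalSpace M] [DiscreteTopology M]
  {R : Type*} [Ring R] [Module R M] {j : V.geomPrimaryTorsion p →+ M} (π : R) (Sπ : AddSubgroup M) (hSπ : ∀ m, m ∈ Sπ ↔ π • m = 0)
  (hπp : ∀ m : M, π • m = 0 → p • m = 0)
  (hTc : ∀ m' : V.geomPrimaryTorsion p, Continuous fun g : absoluteGaloisGroup K ↦ g • m')
  (htriv : ∀ (n : ℕ) (v : HeightOneSpectrum (𝓞 K)), v ∉ S₀ → ((p : ℕ) : 𝓞 K) ∉ v.asIdeal →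
    ∀ (x : inertiaIn (κ.layerSubgroup n) v) (m : M), x • m = m)
  (t : M →+ V.geomPrimaryTorsion p)
  (ht_loc : ∀ v : HeightOneSpectrum (𝓞 K), (p : 𝓞 K) ∈ v.asIdeal →
    ∀ (δ : absoluteGaloisGroup (v.adicCompletion K)) (m : M),
      t (resGalOfEmb (closureEmb (K := K) (v.adicCompletion K)) δ • m) = resGalOfEmb (closureEmb (K := K) (v.adicCompletion K)) δ • t m)
  (ht_gen : ∀ (n : ℕ) (v : HeightOneSpectrum (𝓞 K)), (p : 𝓞 K) ∈ v.asIdeal →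
    ∀ f ∈ localSatGen V p (κ.layerSubgroup n) (closureEmb (K := K) (v.adicCompletion K)) M R j (signedLocalPoints κ (v.adicCompletion K) V ε n),
      (fun τ ↦ t (f τ)) ∈ AddSubgroup.closure (localSatGen V p (κ.layerSubgroup n) (closureEmb (K := K) (v.adicCompletion K))
        (V.geomPrimaryTorsion p) ℤ (AddMonoidHom.id _) (signedLocalPoints κ (v.adicCompletion K) V ε n)))
  (ht_S : ∀ (g : absoluteGaloisGroup K) (m : M), m ∈ Sπ → t (g • m) = g • t m)

include hSπ hπp hTc htriv ht_loc ht_gen ht_S in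
/-- ★ **Descent inputs of a coordinate.** For an `M[π]`-valued cocycle `φ` of `Γ_{K_n}` whose class lies in `Sel^{ε,S₀}_R(K_n, M)` and the pushed cocycle
`ψ = t ∘ φ` along a coordinate `t : M → V[p^∞]` (locally equivariant at `v ∣ p`, closure condition `hgen`, equivariant on `M[π]`): `p • [ψ] = 0`, `[ψ]` satisfies
Kobayashi's condition from `E^ε(K_n·K_v)` at every `v ∣ p`, and `[ψ]` is unramified outside `S₀ ∪ {p}`. [cite: Kobayashi2003, Def. 1.1] [cite: SerreGaloisCohomology1997, I §5.1] -/
theorem descInputs_of_coordinate (n : ℕ) (φ : contOneCocycles (discreteTopRep (κ.layerSubgroup n) M)) (hφ : ∀ x, φ.1 x ∈ Sπ)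
    (hc : oneCocycleClass _ φ ∈ signedTransportSelmerLayerSat κ M R V j S₀ ε n)
    (ψ : contOneCocycles (discreteTopRep (κ.layerSubgroup n) (V.geomPrimaryTorsion p))) (hψ : ∀ x, ψ.1 x = t (φ.1 x)) :
    p • oneCocycleClass _ ψ = 0 ∧
      (∀ v : HeightOneSpectrum (𝓞 K), (p : 𝓞 K) ∈ v.asIdeal →
        oneCocycleClass _ ψ ∈ localKummerOverOfEmb V p (κ.layerSubgroup n) (closureEmb (K := K) (v.adicCompletion K))
          (signedLocalPointsOfEmb κ (closureEmb (K := K) (v.adicCompletion K)) V ε n)) ∧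
      oneCocycleClass _ ψ ∈ unramifiedOutside (κ.layerSubgroup n) (V.geomPrimaryTorsion p) p S₀ := by
  have hsat : oneCocycleClass _ ψ ∈ signedTransportSelmerLayerSat κ (V.geomPrimaryTorsion p) ℤ V (AddMonoidHom.id _) S₀ ε n :=
    mem_signedTransportSelmerLayerSat_of_comp κ S₀ ε n hTc t
      (fun v hv τ m ↦ by rw [resGalSubgroupOfEmb_apply_coe]; exact ht_loc v hv τ m) (fun v hv f hf ↦ ht_gen n v hv f hf) (htriv n) Sπ ht_S φ hφ ψ hψ hc
  refine ⟨nsmul_oneCocycleClass_eq_zero_of_forall p ψ fun x ↦ ?_, fun v hv ↦ ?_, mem_unramifiedOutside_of_mem_signedTransportSelmerLayerSat κ V S₀ ε hsat⟩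
  · rw [hψ, ← map_nsmul, hπp _ ((hSπ _).1 (hφ x)), map_zero]
  · have h := conjH1_mem_localKummerOverOfEmb_of_mem_signedTransportSelmerLayerSat_int κ V S₀ ε hsat hv 1
    rwa [conjH1_one_holds (κ.layerSubgroup n) (V.geomPrimaryTorsion p), AddMonoidHom.id_apply] at h

variable (û : V.geomPrimaryTorsion p →+ V.geomPrimaryTorsion p)
  (hû_loc : ∀ v : HeightOneSpectrum (𝓞 K), (p : 𝓞 K) ∈ v.asIdeal →
    ∀ (δ : absoluteGaloisGroup (v.adicCompletion K)) (x : V.geomPrimaryTorsion p),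
      û (resGalOfEmb (closureEmb (K := K) (v.adicCompletion K)) δ • x) = resGalOfEmb (closureEmb (K := K) (v.adicCompletion K)) δ • û x)
  (hû_stab : ∀ (n : ℕ) (v : HeightOneSpectrum (𝓞 K)), (p : 𝓞 K) ∈ v.asIdeal →
    ∀ (Q : localPoints V (v.adicCompletion K)) (k : ℕ)
      (c : localSubgroupOfEmb (κ.layerSubgroup n) (closureEmb (K := K) (v.adicCompletion K)) → V.geomPrimaryTorsion p),
      (p ^ k) • Q ∈ signedLocalPoints κ (v.adicCompletion K) V ε n →
      (∀ τ, pointsMapOfEmb V (closureEmb (K := K) (v.adicCompletion K)) ((c τ : V.geomPrimaryTorsion p) : V.geomPoints) =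
        (τ : absoluteGaloisGroup (v.adicCompletion K)) • Q - Q) →
      ∃ (Q' : localPoints V (v.adicCompletion K)) (k' : ℕ), (p ^ k') • Q' ∈ signedLocalPoints κ (v.adicCompletion K) V ε n ∧
        ∀ τ, pointsMapOfEmb V (closureEmb (K := K) (v.adicCompletion K)) ((û (c τ) : V.geomPrimaryTorsion p) : V.geomPoints) =
          (τ : absoluteGaloisGroup (v.adicCompletion K)) • Q' - Q')
  (hû_tors : ∀ (g : absoluteGaloisGroup K) (x : V.geomPrimaryTorsion p), p • x = 0 → û (g • x) = g • û x)

include hû_stab in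
/-- A Kummer-stable endomorphism of `V[p^∞]` preserves the saturated local generators (one-term expansion, g17's `comp_mem_closure_localSatGen_of_expansion`).
[cite: Kobayashi2003, Def. 1.1] -/
theorem comp_mem_closure_localSatGen_of_stable (n : ℕ) (v : HeightOneSpectrum (𝓞 K)) (hv : (p : 𝓞 K) ∈ v.asIdeal)
    {f : localSubgroupOfEmb (κ.layerSubgroup n) (closureEmb (K := K) (v.adicCompletion K)) → V.geomPrimaryTorsion p}
    (hf : f ∈ AddSubgroup.closure (localSatGen V p (κ.layerSubgroup n) (closureEmb (K := K) (v.adicCompletion K))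
      (V.geomPrimaryTorsion p) ℤ (AddMonoidHom.id _) (signedLocalPoints κ (v.adicCompletion K) V ε n))) :
    (fun τ ↦ û (f τ)) ∈ AddSubgroup.closure (localSatGen V p (κ.layerSubgroup n) (closureEmb (K := K) (v.adicCompletion K))
      (V.geomPrimaryTorsion p) ℤ (AddMonoidHom.id _) (signedLocalPoints κ (v.adicCompletion K) V ε n)) := by
  refine comp_mem_closure_localSatGen_of_mem_closure _ û (fun g hg ↦ ?_) hf
  refine comp_mem_closure_localSatGen_of_expansion _ û (fun r ↦ ⟨1, fun _ ↦ r, fun _ ↦ û, fun x ↦ ?_, fun _ Q k c hQ hc ↦ hû_stab n v hv Q k c hQ hc⟩) hg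
  rw [Fin.sum_univ_one, AddMonoidHom.id_apply, AddMonoidHom.id_apply, map_zsmul]

omit [TopologicalSpace M] [DiscreteTopology M] in
include hSπ hπp ht_loc ht_gen ht_S hû_loc hû_stab hû_tors in
/-- ★ **The twisted coordinate inherits the hypotheses**: `û ∘ t` is locally equivariant at `v ∣ p`, satisfies the closure condition, and is `Γ_K`-equivariant
on `M[π]` (there its values are `p`-torsion, where `û` is `Γ_K`-equivariant). [cite: Kobayashi2003, Def. 1.1] -/
theorem coordinate_hyps_comp :
    (∀ v : HeightOneSpectrum (𝓞 K), (p : 𝓞 K) ∈ v.asIdeal →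
      ∀ (δ : absoluteGaloisGroup (v.adicCompletion K)) (m : M),
        (û.comp t) (resGalOfEmb (closureEmb (K := K) (v.adicCompletion K)) δ • m) =
          resGalOfEmb (closureEmb (K := K) (v.adicCompletion K)) δ • (û.comp t) m) ∧
    (∀ (n : ℕ) (v : HeightOneSpectrum (𝓞 K)), (p : 𝓞 K) ∈ v.asIdeal →
      ∀ f ∈ localSatGen V p (κ.layerSubgroup n) (closureEmb (K := K) (v.adicCompletion K)) M R j (signedLocalPoints κ (v.adicCompletion K) V ε n),
        (fun τ ↦ (û.comp t) (f τ)) ∈ AddSubgroup.closure (localSatGen V p (κ.layerSubgroup n) (closureEmb (K := K) (v.adicCompletion K))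
          (V.geomPrimaryTorsion p) ℤ (AddMonoidHom.id _) (signedLocalPoints κ (v.adicCompletion K) V ε n))) ∧
    (∀ (g : absoluteGaloisGroup K) (m : M), m ∈ Sπ → (û.comp t) (g • m) = g • (û.comp t) m) := by
  refine ⟨fun v hv δ m ↦ ?_, fun n v hv f hf ↦ comp_mem_closure_localSatGen_of_stable κ V ε û hû_stab n v hv (ht_gen n v hv f hf), fun g m hm ↦ ?_⟩
  · rw [AddMonoidHom.comp_apply, AddMonoidHom.comp_apply, ht_loc v hv, hû_loc v hv]
  · rw [AddMonoidHom.comp_apply, AddMonoidHom.comp_apply, ht_S g m hm, hû_tors g (t m)]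
    rw [← map_nsmul, hπp m ((hSπ m).1 hm), map_zero]

end Coordinate

end Summit.BirchSwinnertonDyer.BirchSwinnertonDyer.Theorems.SmallImageCharSignedSelmer

end
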